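/-
Origin: expansion seat `planner-pub-hodgecm-qw8-g11-0`, handover #10 SPLIT PART 1/2 of tree `HodgeCM/Model/Toy/LefClosureExclusive.lean` fdc99103 (472 l. > 400-line cap) = NEW module `HodgeCM.Model.Toy.LefCoreFree` md5 30760b047c9c55973b3055ebe574342c (165 l.): verbatim section-boundary slice + docstrings; imports: NO rewrite (tree imports only: Mathlib); check-wip LANDABLE rc 0 / 0 warnings / 0 proof-hole; lean -DautoImplicit=false rc 0; frozen copy pub-hodgecm-qw8 (`HOME/pub-hodgecm-qw8-g11/lean/Qw8g11/LefCoreFree.lean`, md5 30760b04, 165 lines);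
landed by the packager successor (mc-unitary-1-g3, gen-8 kit) in gate run 32 as `HodgeCM/Model/Toy/LefCoreFree.lean` (verbatim).
-/
-- HANDOVER (planner-pub-hodgecm-qw8-g11-0, unit pub-hodgecm-qw8-g11): SPLIT PART 1/2 of the installed
-- `HodgeCM.Model.Toy.LefClosureExclusive` (md5 fdc99103, 472 l.; 400-line cap, lean/CONVENTIONS.md) = its §1 (ll. 67–196)
-- verbatim; WIP module `Qw8g11.LefCoreFree`, intended final module `HodgeCM.Model.Toy.LefCoreFree` (NEW file; Mathlib only).
/-
Copyright (c) 2026. All rights reserved.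
Released under Apache 2.0 license as described in the file LICENSE.
-/
import Mathlib

/-!
# A lemma on groups: a central involution outside a core-free subgroup of "co-index two"

Split part 1/2 of `HodgeCM.Model.Toy.LefClosureExclusive` (its §1, unchanged; pure group theory, Mathlib only).

`mem_of_normal_of_coreFree`: in an arbitrary group `G` (no finiteness, no counting), if `c` is a central involution,
`H ≤ G` a subgroup with `c ∉ H`, `P = H ∪ Hc` "of index two" (any two elements outside `P` differ by an element
of `P`, and `P ≠ G`), `H` core-free (`⋂ gHg⁻¹ = 1`) and `H ≠ 1`, then `c` lies in every nontrivial normal subgroup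
of `G`. (Model: `G = D₄`, `c = r²`, `H = ⟨s⟩`, `P = ⟨s, r²⟩`.) The proof pins down `H = {1, h}` and the relation
`g h g⁻¹ = h c` for every `g ∉ P`, from which `c` is a product of two conjugates of any `n ≠ 1`. The dictionary to a
non-normal quartic CM field and the quartic mixing theorem are in `HodgeCM.Model.Toy.LefClosureExclusive`.

References: Mathlib only. Nothing is posited; no cited fact; no data.
-/

noncomputable section

set_option backward.isDefEq.respectTransparency false

namespace HodgeCM.Toy

/-! ### 1. A lemma on groups: a central involution outside a core-free subgroup of "co-index two" lies in every
nontrivial normal subgroup -/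

section GroupLemma

variable {G : Type*} [Group G] (c : G) (H : Subgroup G)

/-- the subgroup `H⟨c⟩ = H ∪ Hc` for a central involution `c` -/
def adjoinInv (hz : ∀ g : G, g * c = c * g) (hcc : c * c = 1) : Subgroup G where
  carrier := {x | x ∈ H ∨ x * c ∈ H}
  mul_mem' := by
    rintro x y (hx | hx) (hy | hy)
    · exact Or.inl (H.mul_mem hx hy)
    · exact Or.inr (by rw [mul_assoc]; exact H.mul_mem hx hy)
    · refine Or.inr ?_
      have : x * y * c = x * c * y := by rw [mul_assoc, hz y, ← mul_assoc]
      rw [this]; exact H.mul_mem hx hy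
    · refine Or.inl ?_
      have : x * y = x * c * (y * c) := by
        rw [mul_assoc, ← mul_assoc c, ← hz y, mul_assoc y, hcc, mul_one]
      rw [this]; exact H.mul_mem hx hy
  one_mem' := Or.inl H.one_mem
  inv_mem' := by
    rintro x (hx | hx)
    · exact Or.inl (H.inv_mem hx)
    · refine Or.inr ?_
      have : x⁻¹ * c = (x * c)⁻¹ := by
        rw [mul_inv_rev, inv_eq_of_mul_eq_one_right hcc, hz]
      rw [this]; exact H.inv_mem hx

variable {c H}

/-- membership in `adjoinInv c H` (the subgroup `H ∪ Hc`): `x ∈ H` or `x * c ∈ H` -/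
theorem mem_adjoinInv {hz : ∀ g : G, g * c = c * g} {hcc : c * c = 1} {x : G} :
    x ∈ adjoinInv c H hz hcc ↔ x ∈ H ∨ x * c ∈ H := Iff.rfl

/-- **Group lemma.** `c` a central involution, `H` a subgroup with `c ∉ H`, `P = H⟨c⟩ = H ∪ Hc` of index two,
`H` core-free and nontrivial: then `c` lies in every nontrivial normal subgroup. (Model case: `G = D₄`, `c = r²`,
`H = ⟨s⟩`, `P = ⟨s, r²⟩`; the lemma needs no finiteness and no counting.) -/
theorem mem_of_normal_of_coreFree (hz : ∀ g : G, g * c = c * g) (hcc : c * c = 1) (hcH : c ∉ H)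
    (P : Subgroup G) (hP : ∀ x : G, x ∈ P ↔ x ∈ H ∨ x * c ∈ H)
    (hidx : ∀ x y : G, x ∉ P → y ∉ P → x⁻¹ * y ∈ P) (hne : ∃ g : G, g ∉ P)
    (hcore : ∀ x ∈ H, (∀ g : G, g * x * g⁻¹ ∈ H) → x = 1) (hH : ∃ h ∈ H, h ≠ 1)
    (N : Subgroup G) [hN : N.Normal] (hN1 : ∃ n ∈ N, n ≠ 1) : c ∈ N := by
  have hcinv : c⁻¹ = c := inv_eq_of_mul_eq_one_right hcc
  have hzc : ∀ x : G, c * x * c⁻¹ = x := fun x => by rw [← hz x, mul_inv_cancel_right]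
  have hHP : ∀ h ∈ H, h ∈ P := fun h hh => (hP h).mpr (Or.inl hh)
  -- (L1) `P` normalises `H`
  have L1 : ∀ k ∈ P, ∀ h ∈ H, k * h * k⁻¹ ∈ H := by
    intro k hk h hh
    rcases (hP k).mp hk with hk | hk
    · exact H.mul_mem (H.mul_mem hk hh) (H.inv_mem hk)
    · have e : k * h * k⁻¹ = (k * c) * h * (k * c)⁻¹ := by
        rw [show (k * c) * h * (k * c)⁻¹ = k * (c * h * c⁻¹) * k⁻¹ by group, hzc]
      rw [e]
      exact H.mul_mem (H.mul_mem hk hh) (H.inv_mem hk)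
  -- outside `P`: inverses stay outside, and any two elements differ by an element of `P`
  have hout_inv : ∀ g : G, g ∉ P → g⁻¹ ∉ P := fun g hg hg' => hg (by simpa using P.inv_mem hg')
  -- (L2) a conjugate of `H` by an element outside `P` meets `H` trivially (core-freeness)
  have L2 : ∀ g : G, g ∉ P → ∀ h ∈ H, g * h * g⁻¹ ∈ H → h = 1 := by
    intro g hg h hh hgh
    refine hcore h hh fun g' => ?_
    by_cases hg' : g' ∈ P
    · exact L1 g' hg' h hh
    · have hk : g * g'⁻¹ ∈ P := by simpa using hidx g⁻¹ g'⁻¹ (hout_inv g hg) (hout_inv g' hg')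
      rw [show g' * h * g'⁻¹ = (g * g'⁻¹)⁻¹ * (g * h * g⁻¹) * (g * g'⁻¹)⁻¹⁻¹ by group]
      exact L1 _ (P.inv_mem hk) _ hgh
  -- conjugates of elements of `H` by `g ∉ P` stay in `P`
  have hconj_mem : ∀ g : G, g ∉ P → ∀ h ∈ H, g * h * g⁻¹ ∈ P := by
    intro g hg h hh
    by_contra hx
    have h1 : h * g⁻¹ ∈ P := by
      have := hidx g (g * h * g⁻¹) hg hx
      rwa [show g⁻¹ * (g * h * g⁻¹) = h * g⁻¹ by group] at this
    have h2 : g⁻¹ ∈ P := by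
      have := P.mul_mem (P.inv_mem (hHP h hh)) h1
      rwa [inv_mul_cancel_left] at this
    exact hout_inv g hg h2
  -- (L3) hence `g h g⁻¹ c ∈ H` for `h ≠ 1`
  have L3 : ∀ g : G, g ∉ P → ∀ h ∈ H, h ≠ 1 → g * h * g⁻¹ * c ∈ H := by
    intro g hg h hh h1
    rcases (hP _).mp (hconj_mem g hg h hh) with hx | hx
    · exact absurd (L2 g hg h hh hx) h1
    · exact hx
  -- (L4) `H` has at most one nontrivial element
  have L4 : ∀ h ∈ H, ∀ h' ∈ H, h ≠ 1 → h' ≠ 1 → h = h' := by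
    obtain ⟨g, hg⟩ := hne
    intro h hh h' hh' h1 h1'
    have ha := L3 g hg h hh h1
    have hb := L3 g hg h' hh' h1'
    have hab : g * (h * h'⁻¹) * g⁻¹ = (g * h * g⁻¹ * c) * (g * h' * g⁻¹ * c)⁻¹ := by group
    exact mul_inv_eq_one.mp
      (L2 g hg (h * h'⁻¹) (H.mul_mem hh (H.inv_mem hh')) (by rw [hab]; exact H.mul_mem ha (H.inv_mem hb)))
  -- (L5) KEY RELATION: conjugating a nontrivial `h ∈ H` by any `g ∉ P` multiplies it by `c`
  have L5 : ∀ g : G, g ∉ P → ∀ h ∈ H, h ≠ 1 → g * h * g⁻¹ = h * c := by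
    intro g hg h hh h1
    have ha := L3 g hg h hh h1
    by_cases ha1 : g * h * g⁻¹ * c = 1
    · exfalso
      have h2 : g * h * g⁻¹ = c := by rw [← hcinv]; exact eq_inv_of_mul_eq_one_left ha1
      have h3 : h = g⁻¹ * (g * h * g⁻¹) * g := by group
      rw [h2, hz g⁻¹, inv_mul_cancel_right] at h3
      exact hcH (h3 ▸ hh)
    · exact (eq_mul_inv_of_mul_eq (L4 _ ha h hh ha1 h1)).trans (by rw [hcinv])
  -- MAIN
  obtain ⟨h₀, hh₀, h₀1⟩ := hH
  obtain ⟨n, hn, hn1⟩ := hN1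
  by_cases hnp : n ∈ P
  · obtain ⟨g, hg⟩ := hne
    have hgn : g * n * g⁻¹ ∈ N := hN.conj_mem n hn g
    rcases (hP n).mp hnp with hnH | hnH
    · -- `n ∈ H`, `n ≠ 1`: `g n g⁻¹ = n c`
      rw [show c = n⁻¹ * (g * n * g⁻¹) by rw [L5 g hg n hnH hn1]; group]
      exact N.mul_mem (N.inv_mem hn) hgn
    · by_cases hnc : n * c = 1
      · rw [← hcinv, ← eq_inv_of_mul_eq_one_left hnc]; exact hn
      · -- `g (n c) g⁻¹ = n c c = n`, so `g n g⁻¹ = n c`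
        have key := L5 g hg (n * c) hnH hnc
        have e1 : g * (n * c) * g⁻¹ = g * n * g⁻¹ * c := by
          rw [show g * (n * c) * g⁻¹ = g * n * (c * g⁻¹) by group, ← hz g⁻¹]; group
        rw [e1, mul_assoc n, hcc, mul_one] at key
        have key' : g * n * g⁻¹ = n * c := by rw [← hcinv]; exact eq_mul_inv_of_mul_eq key
        rw [show c = n⁻¹ * (g * n * g⁻¹) by rw [key']; group]
        exact N.mul_mem (N.inv_mem hn) hgn
  · -- `n ∉ P`: conjugation by `n` itself gives `n h₀ n⁻¹ = h₀ c`, so `c = (h₀⁻¹ n h₀) n⁻¹ ∈ N`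
    have key := L5 n hnp h₀ hh₀ h₀1
    rw [show c = h₀⁻¹ * n * h₀ * n⁻¹ by
      rw [show h₀⁻¹ * n * h₀ * n⁻¹ = h₀⁻¹ * (n * h₀ * n⁻¹) by group, key]; group]
    exact N.mul_mem (by simpa using hN.conj_mem n hn h₀⁻¹) (N.inv_mem hn)

end GroupLemma

end HodgeCM.Toy

end
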